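import Summits.AtomisticToContinuum.FouriersLaw.Theorems.PhononMeanFreePathCoherentDephasingHeadBound

/-!
# Line `Sketch` of crux `PhononMeanFreePath.CoherentDephasing` (stmt-AtomisticToContinuum-11810): the `N`-uniform bound on the symmetric harmonic flux

Registered stub `stub_harmFluxBound` (head input of the line's route B′ composition), proved with exactly the
registered signature. For the `(N+1)`-site pinned anharmonic chain `pinnedChain ω₂ lam β γ` (all parameters `> 0`)
with both Langevin baths at `T > 0`, the time-integrated symmetric harmonic coherent flux through a bond
`b = (b, b+1)` (vocabulary `Theorems/PhononMeanFreePathDefs`, section SiteBookkeeping),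

  `harmFlux … N b = -½ ∫₀^∞ (m_b + m_{b+1}) (n_{b+1} - n_b) dt`,  `m_x = momResp`, `n_x = posResp`,

is bounded above by one constant `B(ω₂, lam, β, γ, T)` for ALL `N` and ALL bonds `b`.

**Proof** (the technique of `…CoherentDephasingHeadBound`). Pointwise
`-½ (m + m')(n' - n) ≤ ¼ (m + m')² + ¼ (n' - n)² ≤ ½ (m² + m'²) + ½ (n'² + n²)`; the four time integrals are bounded
UNIFORMLY IN `N` by the dissipation bound of the equilibrium semigroup
(`integral_kickResp_sq_le`, file `…CoherentDephasingKickDissipation`): `∫₀^∞ m_x² ≤ (T/(2γ)) ∫ p_x² dμ_T = T²/(2γ)` and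
`∫₀^∞ n_x² ≤ (T/(2γ)) ∫ q_x² dμ_T ≤ (T/(2γ)) C₁` with the `N`-uniform Gibbs second moment `C₁`
(`gibbs_position_moment_le`, Brascamp–Lieb via `stub_gibbsPoincare`/`stub_gibbsMoments`). If the product is not
integrable the flux is the Bochner junk value `0 ≤ B`.
-/

noncomputable section

open MeasureTheory ProbabilityTheory Filter Topology Set
open scoped NNReal ENNReal

namespace Summit.AtomisticToContinuum.FouriersLaw.Theorems.CoherentDephasing.HarmFluxBound

open Literature.MathematicalPhysics.KineticTheory.HeatConduction
open Literature.MathematicalPhysics.KineticTheory Literature.Probability.Process OscillatorChain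
open Summit.AtomisticToContinuum.FouriersLaw.Theorems.PhononMeanFreePath
open Summit.AtomisticToContinuum.FouriersLaw.Theorems.SubdiffusiveBondHeat
open Summit.AtomisticToContinuum.FouriersLaw.Theorems.CoherentDephasing.KickDissipation
open Summit.AtomisticToContinuum.FouriersLaw.Theorems.CoherentDephasing.HeadBound

/-- The pointwise inequality behind the bound: `-½ (m + m')(n' - n) ≤ ½ (m² + m'²) + ½ (n'² + n²)`.
[folklore] -/
theorem neg_half_mul_le (m m' n n' : ℝ) :
    -(1 / 2) * ((m + m') * (n' - n)) ≤ (m ^ 2 + m' ^ 2) / 2 + (n' ^ 2 + n ^ 2) / 2 := by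
  nlinarith [sq_nonneg (m + m' + (n' - n)), sq_nonneg (m - m'), sq_nonneg (n' + n)]

section Main

variable {ω₂ lam β γ : ℝ} (hω : 0 < ω₂) (hl : 0 ≤ lam) (hβ : 0 < β) (hγ : 0 < γ) {T : ℝ} (hT : 0 < T)
include hω hl hβ hγ hT

/-- **`N`-uniform `L²(dt)` bounds of the momentum and position responses** at every site of the `(N+1)`-site
chain: `t ↦ m_x², n_x² ∈ L¹(0,∞)`, `∫₀^∞ m_x² ≤ T²/(2γ)` and `∫₀^∞ n_x² ≤ (T/(2γ)) ∫ q_x² dμ_T`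
(`kickResp_sq_integral_le` for `g = p_x`, `g = q_x`; equipartition `∫ p_x² dμ_T = T`). [folklore] -/
theorem momResp_posResp_sq_bounds (N : ℕ) (x : Fin (N + 1)) :
    IntegrableOn (fun t => momResp ω₂ lam β γ T N x t ^ 2) (Ioi 0) ∧
      IntegrableOn (fun t => posResp ω₂ lam β γ T N x t ^ 2) (Ioi 0) ∧
      ∫ t in Ioi (0 : ℝ), momResp ω₂ lam β γ T N x t ^ 2 ≤ T ^ 2 / (2 * γ) ∧
      ∫ t in Ioi (0 : ℝ), posResp ω₂ lam β γ T N x t ^ 2 ≤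
        T / (2 * γ) * ∫ y, (y.1 x) ^ 2 ∂((pinnedChain ω₂ lam β γ).gibbsMeasure (N + 1) T) := by
  have hϑ0 : (0 : ℝ) < 1 / (4 * T) := by positivity
  have hpB : ∀ y : PhaseSpace (N + 1), |y.2 x| ≤
      (1 / 2 + 1 / (1 / (4 * T))) * Real.exp (1 / (4 * T) * (pinnedChain ω₂ lam β γ).hamiltonian (N + 1) y) :=
    fun y => CoherentDephasing.abs_momentum_le_exp hω.le hl hβ.le hϑ0 y x
  have hqB : ∀ y : PhaseSpace (N + 1), |y.1 x| ≤
      ((1 + ω₂⁻¹) ^ 1 * ((1 : ℕ).factorial / (1 / (4 * T)) ^ 1 * Real.exp (1 / (4 * T)))) *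
        Real.exp (1 / (4 * T) * (pinnedChain ω₂ lam β γ).hamiltonian (N + 1) y) := fun y => by
    have h := abs_position_pow_le_exp hω hl hβ.le γ hϑ0 1 (N + 1) y x
    rwa [pow_one (|y.1 x|)] at h
  have hpc : Continuous fun y : PhaseSpace (N + 1) => y.2 x := by fun_prop
  have hqc : Continuous fun y : PhaseSpace (N + 1) => y.1 x := by fun_prop
  refine ⟨kickResp_sq_integrableOn hω hl hβ hγ hT N hpc hpB, kickResp_sq_integrableOn hω hl hβ hγ hT N hqc hqB,
    ?_, integral_kickResp_sq_le hω hl hβ hγ hT N hqc hqB⟩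
  have h := integral_kickResp_sq_le hω hl hβ hγ hT N hpc hpB
  rw [pinnedChain_integral_momentum_sq_gibbsMeasure hω hl hβ.le (N + 1) hT x] at h
  calc ∫ t in Ioi (0 : ℝ), momResp ω₂ lam β γ T N x t ^ 2 ≤ T / (2 * γ) * T := h
    _ = T ^ 2 / (2 * γ) := by ring

/-- **`N`-uniform bound on the symmetric harmonic flux through every bond.** With `C₁` the `N`-uniform Gibbs
second moment of the positions: `harmFlux … N b ≤ (2 T²/(2γ) + 2 (T/(2γ)) C₁)/2` for every `N` and every bond
`b`. [folklore] -/
theorem harmFlux_le_uniform : ∃ B : ℝ, ∀ (N : ℕ) (b : Fin N), harmFlux ω₂ lam β γ T N b ≤ B := by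
  obtain ⟨C₁, hC₁⟩ := gibbs_position_moment_le hω hl hβ.le γ hT 1
  have hC2 : ∀ (N : ℕ) (i : Fin N), ∫ x, (x.1 i) ^ 2 ∂((pinnedChain ω₂ lam β γ).gibbsMeasure N T) ≤ C₁ :=
    fun N i => by simpa using hC₁ N i
  have hC₁0 : 0 ≤ C₁ :=
    (integral_nonneg (μ := (pinnedChain ω₂ lam β γ).gibbsMeasure 1 T)
      fun x : PhaseSpace 1 => even_two.pow_nonneg (x.1 0)).trans (hC2 1 0)
  refine ⟨((T ^ 2 / (2 * γ) + T ^ 2 / (2 * γ)) / 2 + (T / (2 * γ) * C₁ + T / (2 * γ) * C₁) / 2), fun N b => ?_⟩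
  have hB0 : 0 ≤ (T ^ 2 / (2 * γ) + T ^ 2 / (2 * γ)) / 2 + (T / (2 * γ) * C₁ + T / (2 * γ) * C₁) / 2 := by
    positivity
  obtain ⟨hmI, hnI, hm2, hn2⟩ := momResp_posResp_sq_bounds hω hl hβ hγ hT N b.castSucc
  obtain ⟨hmI', hnI', hm2', hn2'⟩ := momResp_posResp_sq_bounds hω hl hβ hγ hT N b.succ
  have hn3 : ∫ t in Ioi (0 : ℝ), posResp ω₂ lam β γ T N b.castSucc t ^ 2 ≤ T / (2 * γ) * C₁ :=
    hn2.trans (mul_le_mul_of_nonneg_left (hC2 (N + 1) b.castSucc) (by positivity))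
  have hn3' : ∫ t in Ioi (0 : ℝ), posResp ω₂ lam β γ T N b.succ t ^ 2 ≤ T / (2 * γ) * C₁ :=
    hn2'.trans (mul_le_mul_of_nonneg_left (hC2 (N + 1) b.succ) (by positivity))
  show -(1 / 2) * (∫ t in Ioi (0 : ℝ), (momResp ω₂ lam β γ T N b.castSucc t + momResp ω₂ lam β γ T N b.succ t) *
    (posResp ω₂ lam β γ T N b.succ t - posResp ω₂ lam β γ T N b.castSucc t)) ≤ _
  by_cases hI : IntegrableOn (fun t => (momResp ω₂ lam β γ T N b.castSucc t + momResp ω₂ lam β γ T N b.succ t) *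
      (posResp ω₂ lam β γ T N b.succ t - posResp ω₂ lam β γ T N b.castSucc t)) (Ioi 0)
  · rw [← integral_const_mul]
    have hsum : IntegrableOn (fun t =>
        (momResp ω₂ lam β γ T N b.castSucc t ^ 2 + momResp ω₂ lam β γ T N b.succ t ^ 2) / 2 +
          (posResp ω₂ lam β γ T N b.succ t ^ 2 + posResp ω₂ lam β γ T N b.castSucc t ^ 2) / 2) (Ioi 0) :=
      ((hmI.fun_add hmI').div_const 2).fun_add ((hnI'.fun_add hnI).div_const 2)
    calc ∫ t in Ioi (0 : ℝ), -(1 / 2) * ((momResp ω₂ lam β γ T N b.castSucc t + momResp ω₂ lam β γ T N b.succ t) *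
            (posResp ω₂ lam β γ T N b.succ t - posResp ω₂ lam β γ T N b.castSucc t))
        ≤ ∫ t in Ioi (0 : ℝ), ((momResp ω₂ lam β γ T N b.castSucc t ^ 2 + momResp ω₂ lam β γ T N b.succ t ^ 2) / 2 +
            (posResp ω₂ lam β γ T N b.succ t ^ 2 + posResp ω₂ lam β γ T N b.castSucc t ^ 2) / 2) :=
          integral_mono (hI.const_mul _) hsum fun t => neg_half_mul_le _ _ _ _
      _ = ((∫ t in Ioi (0 : ℝ), momResp ω₂ lam β γ T N b.castSucc t ^ 2) +
              ∫ t in Ioi (0 : ℝ), momResp ω₂ lam β γ T N b.succ t ^ 2) / 2 +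
            ((∫ t in Ioi (0 : ℝ), posResp ω₂ lam β γ T N b.succ t ^ 2) +
              ∫ t in Ioi (0 : ℝ), posResp ω₂ lam β γ T N b.castSucc t ^ 2) / 2 := by
          rw [integral_add ((hmI.fun_add hmI').div_const 2) ((hnI'.fun_add hnI).div_const 2), integral_div,
            integral_div, integral_add hmI hmI', integral_add hnI' hnI]
      _ ≤ (T ^ 2 / (2 * γ) + T ^ 2 / (2 * γ)) / 2 + (T / (2 * γ) * C₁ + T / (2 * γ) * C₁) / 2 := by
          linarith
  · rw [integral_undef hI, mul_zero]
    exact hB0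

end Main

/-- **stub_harmFluxBound** (registered stub of line `Sketch`, crux `PhononMeanFreePath.CoherentDephasing`): for
every admissible parameter point there is `B` with `harmFlux … N b ≤ B` for all `N` and all bonds `b` of the
`(N+1)`-site chain — the dissipation inequality of the equilibrium semigroup bounds `∫₀^∞ m_x²` and `∫₀^∞ n_x²`
uniformly in `N` (the latter through the `N`-uniform Gibbs second moment of `q_x`, Brascamp–Lieb), and
`-½(m + m')(n' - n) ≤ ½(m² + m'²) + ½(n'² + n²)`. [folklore] -/
theorem stub_harmFluxBound : ∀ ω₂ lam β γ : ℝ, 0 < ω₂ → 0 < lam → 0 < β → 0 < γ → ∀ T : ℝ, 0 < T →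
    ∃ B : ℝ, ∀ (N : ℕ) (b : Fin N), harmFlux ω₂ lam β γ T N b ≤ B :=
  fun _ _ _ _ hω hl hβ hγ _ hT => harmFlux_le_uniform hω hl.le hβ hγ hT

end Summit.AtomisticToContinuum.FouriersLaw.Theorems.CoherentDephasing.HarmFluxBound

end
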